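import Summits.NavierStokesRegularity.FluidComputer.ModulatedCollapseGaugeRigidity
import HarnessLib

/-!
# The TWO-clock one-profile collapse `u = μ(t) U(λ(t) x)`: normal form — critical coupling
# `μ ∝ λ` (then Leray, by `ModulatedCollapseGaugeRigidity`), or a LINEARLY DEGENERATE profile

Summit `NavierStokesRegularity`, cell topic directory `FluidComputer`, namespace
`…FluidComputer.SelfSimilarCensus`; sequel of `ModulatedCollapseGaugeRigidity.lean` (one clock,
`μ = λ`) and of `SelfSimilarCollapseViscousRigidity.lean` (row (M16): the power-law two-clock ansatz
`μ = (T−t)^{γ−1}`, `λ = (T−t)^{−γ}`, `γ ≠ ½`, forces a harmonic self-similar Euler profile). Here BOTH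
clocks are ARBITRARY: amplitude `μ(t)` and inverse length `λ(t)`, differentiable and non-vanishing on
a set `S` of times; profile `U ∈ C¹(E; E)`, pressure profile `P : E → ℝ`, ansatz
`u(t, x) = μ(t) • U(λ(t) • x)`, `p(t, x) = μ(t)² P(λ(t) • x)` (the pressure scale `μ²` is the one
printed with every self-similar ansatz; Type-II one-profile templates are `μ/λ → ∞`). PROVED theorems
only; no definitions, no data, no named facts.

## The observation (folklore linear algebra on the exact ansatz)

At `y = λ(t) x` and for every `ν` (`momentum_twoClock`, `fourTerm_of_momentum`):

  `(μλ²)⁻¹ · (∂ₜu + (u·∇)u + ∇p − νΔu) = b(t) U(y) + a(t) DU(y) y + c(t) N₀(y) − ν ΔU(y)`,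
  `b := μ′/(μλ²)`, `a := λ′/λ³`, `c := μ/λ`, `N₀ := (U·∇)U + ∇P`.

So if the momentum equation holds on `S × E`, the curve `t ↦ (b, a, c)(t)` is confined to an affine
subspace whose directions are linear relations among the profile fields `U`, `DU·y`, `N₀` (the `ν ΔU`
column is constant in `t`). Consequences:

* `convect_add_gradient_eq_of_ratio_ne` — if the amplitude-to-inverse-length ratio `c = μ/λ` takes
  two values on `S` (non-critical coupling, e.g. any Type-II one-profile template), then the Euler
  nonlinearity of the profile is LINEAR IN DISGUISE: `(U·∇)U + ∇P = α U + β DU·y` for two constants;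
* `laplacian_eq_of_ratio_ne` — and then `ν ΔU = p₁ U + p₂ DU·y` for two constants (an
  Ornstein–Uhlenbeck / Hermite-type linear equation; for `ν = 0` a homogeneity relation);
* `twoClock_normalForm` — THE NORMAL FORM: either `μ = κ λ` on `S` for one constant `κ` (critical
  coupling: the ansatz is `nsRescaleData (λ t) (κ • U)`, `twoClock_eq_nsRescaleData`, and the one-clock
  rigidity of `ModulatedCollapseGaugeRigidity` applies — Leray's clock or `U ≡ 0`), or the profile is
  linearly degenerate in the above sense. The power-law case of (M16) is the instance
  `(b, a, c) = (T−t)^{2γ−1} (1−γ, γ, 1)`: one direction `(1−γ, γ, 1)` (the self-similar Euler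
  profile equation) plus `ΔU ≡ 0`.

## WHAT THIS IS NOT

Not a statement about similarity-time dependent profiles, not a regularity theorem, not
Navier–Stokes evidence; the degenerate branch is NOT empty (constant and linear flows
`u = μ(t)U₀`, `u = μ(t)λ(t) A x` are exact infinite-energy members) and is not classified further
here. «violates: none — no object».

## Tree / Mathlib tools

`fderiv_const_smul_comp_smul'`, `laplacian_const_smul_comp_smul`, `nsRescaleData`,
`mul_eq_mul_of_twoTerm`-style elimination done inline; Mathlib `HasDerivAt.smul`,
`HasFDerivAt.comp_hasDerivAt`, `match_scalars`, `module`, `field_simp`.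

## References

* J. Leray, Acta Math. 63 (1934), §20, (3.11)–(3.12). [Leray1934]
* J. Nečas, M. Růžička, V. Šverák, Acta Math. 176 (1996), Introduction. [NecasRuzickaSverak1996]
* P. Constantin, M. Ignatova, V. Vicol, arXiv:2602.17570 (2026), §3.1 (3.2) (the power-law
  two-clock ansatz). [ConstantinIgnatovaVicol2026Putative]
-/

noncomputable section

open Set Filter Topology InnerProductSpace
open scoped Laplacian RealInnerProductSpace

namespace Summit.NavierStokesRegularity.FluidComputer.SelfSimilarCensus

open Literature.Analysis.FluidPDE

/-! ### §1 Calculus of the two-clock slice and the momentum identity -/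

section Calculus

variable {E : Type*} [NormedAddCommGroup E] [InnerProductSpace ℝ E] [FiniteDimensional ℝ E]
variable {U : E → E} {P : E → ℝ} {μ lam : ℝ → ℝ} {μ' lam' t : ℝ}

omit [FiniteDimensional ℝ E] in
/-- **Time line of the two-clock ansatz**: for `U ∈ C¹`,
`∂ₜ [μ(t) • U(λ(t) • x)] = μ′ • U(y) + (μ λ′) • DU(y) x`, `y = λ(t) x`. [folklore] -/
theorem hasDerivAt_twoClock_time (hμ : HasDerivAt μ μ' t) (hlam : HasDerivAt lam lam' t)
    (hU : ContDiff ℝ 1 U) (x : E) :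
    HasDerivAt (fun s => μ s • U (lam s • x))
      (μ' • U (lam t • x) + (μ t * lam') • fderiv ℝ U (lam t • x) x) t := by
  have h2 : HasDerivAt (fun s => U (lam s • x)) (fderiv ℝ U (lam t • x) (lam' • x)) t :=
    ((hU.differentiable one_ne_zero (lam t • x)).hasFDerivAt).comp_hasDerivAt t (hlam.smul_const x)
  refine (hμ.smul h2).congr_deriv ?_
  simp only [map_smul]
  module

/-- Gradient of the two-clock pressure slice `x ↦ a P(c • x)`: `(a c) • (∇P)(c • x)` (no regularity
needed). [folklore] -/
theorem gradient_const_mul_comp_smul (P : E → ℝ) (a c : ℝ) (x : E) :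
    gradient (fun y => a * P (c • y)) x = (a * c) • gradient P (c • x) := by
  have h : (fun y => a * P (c • y)) = fun y => a • P (c • y) := rfl
  rw [h, gradient, fderiv_const_smul_comp_smul' P a c x, map_smul]
  rfl

/-- **The momentum operator on the two-clock ansatz** (`λ(t) ≠ 0`, `U ∈ C¹`, any `P`, any `ν`),
at `y = λ(t) x`:
`∂ₜu + (u·∇)u + ∇p − νΔu = μ′ • U(y) + (μλ′) • DU(y) x + (μ²λ) • ((U·∇)U + ∇P)(y) − (νμλ²) • ΔU(y)`.
[folklore] -/
theorem momentum_twoClock (hμ : HasDerivAt μ μ' t) (hlam : HasDerivAt lam lam' t) (hl : lam t ≠ 0)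
    (hU : ContDiff ℝ 1 U) (P : E → ℝ) (ν : ℝ) (x : E) :
    timeDeriv (fun s z => μ s • U (lam s • z)) t x +
        convect (fun z => μ t • U (lam t • z)) (fun z => μ t • U (lam t • z)) x +
        gradient (fun z => μ t ^ 2 * P (lam t • z)) x -
        ν • (Δ (fun z => μ t • U (lam t • z))) x =
      μ' • U (lam t • x) + (μ t * lam') • fderiv ℝ U (lam t • x) x +
        (μ t ^ 2 * lam t) • (convect U U (lam t • x) + gradient P (lam t • x)) -
        (ν * (μ t * lam t ^ 2)) • (Δ U) (lam t • x) := by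
  rw [timeDeriv_apply, (hasDerivAt_twoClock_time hμ hlam hU x).deriv, convect,
    fderiv_const_smul_comp_smul' U (μ t) (lam t) x, gradient_const_mul_comp_smul,
    laplacian_const_smul_comp_smul U (μ t) hl x, convect]
  simp only [smul_apply, map_smul]
  module

end Calculus

/-! ### §2 The normalised four-term identity and the normal form -/

section NormalForm

variable {E : Type*} [NormedAddCommGroup E] [InnerProductSpace ℝ E] [FiniteDimensional ℝ E]
variable {S : Set ℝ} {U : E → E} {P : E → ℝ} {μ lam μ' lam' : ℝ → ℝ} {ν : ℝ}

/-! Standing hypotheses: on `S` both clocks are differentiable (derivatives `μ′`, `λ′`) and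
non-vanishing; `U ∈ C¹(E; E)`; the two-clock ansatz satisfies `∂ₜu + (u·∇)u + ∇p − νΔu = 0` on
`S × E`. -/
variable (hμ : ∀ t ∈ S, HasDerivAt μ (μ' t) t) (hlam : ∀ t ∈ S, HasDerivAt lam (lam' t) t)
  (hμ0 : ∀ t ∈ S, μ t ≠ 0) (hl0 : ∀ t ∈ S, lam t ≠ 0) (hU : ContDiff ℝ 1 U)
  (heq : ∀ t ∈ S, ∀ x : E,
    timeDeriv (fun s z => μ s • U (lam s • z)) t x +
        convect (fun z => μ t • U (lam t • z)) (fun z => μ t • U (lam t • z)) x +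
        gradient (fun z => μ t ^ 2 * P (lam t • z)) x -
        ν • (Δ (fun z => μ t • U (lam t • z))) x = 0)
include hμ hlam hμ0 hl0 hU heq

/-- **The normalised four-term identity.** For every `t ∈ S` and every `y ∈ E`:
`(μ′/(μλ²)) • U(y) + (λ′/λ³) • DU(y) y + (μ/λ) • ((U·∇)U + ∇P)(y) − ν • ΔU(y) = 0`
(the momentum identity at `x = λ⁻¹ y`, divided by `μλ²`). [folklore] -/
theorem fourTerm_of_momentum {t : ℝ} (ht : t ∈ S) (y : E) :
    (μ' t / (μ t * lam t ^ 2)) • U y + (lam' t / lam t ^ 3) • fderiv ℝ U y y +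
      (μ t / lam t) • (convect U U y + gradient P y) - ν • (Δ U) y = 0 := by
  have hl := hl0 t ht
  have hm := hμ0 t ht
  have hx := heq t ht ((lam t)⁻¹ • y)
  rw [momentum_twoClock (hμ t ht) (hlam t ht) hl hU P ν, smul_smul, mul_inv_cancel₀ hl, one_smul,
    map_smul] at hx
  -- `hx : μ′ • U y + (μλ′) • λ⁻¹ • DU y y + (μ²λ) • N₀ y − (νμλ²) • ΔU y = 0`; scale by `(μλ²)⁻¹`
  have key : (μ' t / (μ t * lam t ^ 2)) • U y + (lam' t / lam t ^ 3) • fderiv ℝ U y y +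
      (μ t / lam t) • (convect U U y + gradient P y) - ν • (Δ U) y =
      (μ t * lam t ^ 2)⁻¹ • (μ' t • U y + (μ t * lam' t) • (lam t)⁻¹ • fderiv ℝ U y y +
        (μ t ^ 2 * lam t) • (convect U U y + gradient P y) -
        (ν * (μ t * lam t ^ 2)) • (Δ U) y) := by
    match_scalars <;> field_simp
  rw [key, hx, smul_zero]

/-- **Non-critical coupling ⇒ the Euler nonlinearity of the profile is linear in disguise.** If the
ratio `μ/λ` takes two different values at `t₁, t₂ ∈ S`, then there are constants `α, β` with
`(U·∇)U(y) + ∇P(y) = α • U(y) + β • DU(y) y` for EVERY `y` (subtract the four-term identities at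
`t₁` and `t₂`: the viscous columns cancel). [folklore] -/
theorem convect_add_gradient_eq_of_ratio_ne {t₁ t₂ : ℝ} (ht₁ : t₁ ∈ S) (ht₂ : t₂ ∈ S)
    (hne : μ t₁ / lam t₁ ≠ μ t₂ / lam t₂) :
    ∃ α β : ℝ, ∀ y, convect U U y + gradient P y = α • U y + β • fderiv ℝ U y y := by
  set c₁ := μ t₁ / lam t₁
  set c₂ := μ t₂ / lam t₂
  set b₁ := μ' t₁ / (μ t₁ * lam t₁ ^ 2)
  set b₂ := μ' t₂ / (μ t₂ * lam t₂ ^ 2)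
  set a₁ := lam' t₁ / lam t₁ ^ 3
  set a₂ := lam' t₂ / lam t₂ ^ 3
  have hc : c₁ - c₂ ≠ 0 := sub_ne_zero.2 hne
  refine ⟨(b₂ - b₁) / (c₁ - c₂), (a₂ - a₁) / (c₁ - c₂), fun y => ?_⟩
  have h1 := fourTerm_of_momentum hμ hlam hμ0 hl0 hU heq ht₁ y
  have h2 := fourTerm_of_momentum hμ hlam hμ0 hl0 hU heq ht₂ y
  have hdiff : (c₁ - c₂) • (convect U U y + gradient P y) -
      ((b₂ - b₁) • U y + (a₂ - a₁) • fderiv ℝ U y y) =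
      (b₁ • U y + a₁ • fderiv ℝ U y y + c₁ • (convect U U y + gradient P y) - ν • (Δ U) y) -
      (b₂ • U y + a₂ • fderiv ℝ U y y + c₂ • (convect U U y + gradient P y) - ν • (Δ U) y) := by
    module
  rw [h1, h2, sub_zero] at hdiff
  have h3 : (c₁ - c₂) • (convect U U y + gradient P y) =
      (b₂ - b₁) • U y + (a₂ - a₁) • fderiv ℝ U y y := sub_eq_zero.1 hdiff
  have h4 : convect U U y + gradient P y =
      (c₁ - c₂)⁻¹ • ((b₂ - b₁) • U y + (a₂ - a₁) • fderiv ℝ U y y) := by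
    rw [← h3, smul_smul, inv_mul_cancel₀ hc, one_smul]
  rw [h4]
  match_scalars <;> field_simp

/-- **… and then the profile solves a LINEAR second-order equation**: with the same `t₁, t₂`, there
are constants `p₁, p₂` with `ν • ΔU(y) = p₁ • U(y) + p₂ • DU(y) y` for every `y` (substitute the
previous relation into the four-term identity at `t₁`). For `ν ≠ 0` this is an Ornstein–Uhlenbeck /
Hermite-type eigen-equation; for `ν = 0` a linear first-order relation. [folklore] -/
theorem laplacian_eq_of_ratio_ne {t₁ t₂ : ℝ} (ht₁ : t₁ ∈ S) (ht₂ : t₂ ∈ S)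
    (hne : μ t₁ / lam t₁ ≠ μ t₂ / lam t₂) :
    ∃ p₁ p₂ : ℝ, ∀ y, ν • (Δ U) y = p₁ • U y + p₂ • fderiv ℝ U y y := by
  obtain ⟨α, β, hN⟩ := convect_add_gradient_eq_of_ratio_ne hμ hlam hμ0 hl0 hU heq ht₁ ht₂ hne
  refine ⟨μ' t₁ / (μ t₁ * lam t₁ ^ 2) + μ t₁ / lam t₁ * α,
    lam' t₁ / lam t₁ ^ 3 + μ t₁ / lam t₁ * β, fun y => ?_⟩
  have h1 := fourTerm_of_momentum hμ hlam hμ0 hl0 hU heq ht₁ y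
  rw [hN y] at h1
  have h2 : ν • (Δ U) y = (μ' t₁ / (μ t₁ * lam t₁ ^ 2)) • U y + (lam' t₁ / lam t₁ ^ 3) • fderiv ℝ U y y +
      (μ t₁ / lam t₁) • (α • U y + β • fderiv ℝ U y y) := (sub_eq_zero.1 h1).symm
  rw [h2]
  module

omit [FiniteDimensional ℝ E] hμ hlam hμ0 hl0 hU heq in
/-- **Critical coupling is the one-clock ansatz.** If `μ(t) = κ λ(t)`, the two-clock slice is the
one-clock slice of the profile `κ • U`: `μ • U(λ ·) = nsRescaleData λ (κ • U)`, and the pressure slice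
`μ² P(λ ·)` is `λ² (κ² P)(λ ·)` — so `ModulatedCollapseGaugeRigidity` applies verbatim. [folklore] -/
theorem twoClock_eq_nsRescaleData {κ : ℝ} {t : ℝ} (hκ : μ t = κ * lam t) :
    (fun z => μ t • U (lam t • z)) = nsRescaleData (lam t) (κ • U) ∧
      (fun z => μ t ^ 2 * P (lam t • z)) = fun z => lam t ^ 2 * (κ ^ 2 • P) (lam t • z) := by
  refine ⟨?_, ?_⟩
  · funext z
    rw [nsRescaleData_apply, Pi.smul_apply, smul_smul, hκ, mul_comm]
  · funext z
    rw [Pi.smul_apply, smul_eq_mul, hκ]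
    ring

/-- **NORMAL FORM of the exact two-clock one-profile collapse.** Under the standing hypotheses,
EITHER the coupling is critical — `μ = κ λ` on `S` for ONE constant `κ` (then the ansatz is the
one-clock ansatz of the profile `κ • U`, `twoClock_eq_nsRescaleData`, and by
`modulatedCollapse_rigidity` the clock is Leray's or `U ≡ 0`) — OR the profile is LINEARLY
DEGENERATE: `(U·∇)U + ∇P = α U + β DU·y` and `ν ΔU = p₁ U + p₂ DU·y` for four constants. In
particular no exact one-profile collapse with a genuinely nonlinear profile has a Type-II
(`μ/λ` non-constant) pair of clocks. [folklore] -/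
theorem twoClock_normalForm :
    (∃ κ : ℝ, ∀ t ∈ S, μ t = κ * lam t) ∨
      ((∃ α β : ℝ, ∀ y, convect U U y + gradient P y = α • U y + β • fderiv ℝ U y y) ∧
        ∃ p₁ p₂ : ℝ, ∀ y, ν • (Δ U) y = p₁ • U y + p₂ • fderiv ℝ U y y) := by
  by_cases h : ∃ t₁ ∈ S, ∃ t₂ ∈ S, μ t₁ / lam t₁ ≠ μ t₂ / lam t₂
  · obtain ⟨t₁, ht₁, t₂, ht₂, hne⟩ := h
    exact Or.inr ⟨convect_add_gradient_eq_of_ratio_ne hμ hlam hμ0 hl0 hU heq ht₁ ht₂ hne,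
      laplacian_eq_of_ratio_ne hμ hlam hμ0 hl0 hU heq ht₁ ht₂ hne⟩
  · left
    push Not at h
    rcases S.eq_empty_or_nonempty with hS | ⟨t₀, ht₀⟩
    · exact ⟨0, fun t ht => by simp [hS] at ht⟩
    · refine ⟨μ t₀ / lam t₀, fun t ht => ?_⟩
      have := h t ht t₀ ht₀
      rw [← this, div_mul_cancel₀ _ (hl0 t ht)]

end NormalForm

end Summit.NavierStokesRegularity.FluidComputer.SelfSimilarCensus

end
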